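import Summits.QuantumFields.YangMills.Theorems.BalabanUVNodesN15TwoGridLandauKernel
import HarnessLib

/-!
# Route «BalabanUVNodes», node N15 = NE2, -a lane, part 49: DOOR (iv) — THE TWO-GRID RATE OF THE UNIT-LATTICE INVERSE `(Q′G′²Q′*)⁻¹` FROM THE PAIRED RATE OF
# `G′Q′*` (resolvent identity on the unit torus + Riemann∕cell sums), so that ENTRY 0 of `𝔇(G′, G)` for Bałaban's full propagator follows from the TWO-GRID RATES OF
# ONE SCALAR KERNEL `K_T = G′Q′*` AND OF ITS GRADIENT (King's Prop. 3.8 (3.71) lines 1–2 SHAPE for b04's kernel)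

Cell `pub-ymgap`, seat `pub-ymgap-dag-n15-a` (KNIT-BY-NAME, g12); `--supports stmt-QuantumFields-20290 --as helper`; `HOME/pub-ymgap-dag-n15-a/DOOR-IV-PLAN.md` §7.4(a).
Over part 48 (`abs_sum_mul_sum_mul_le`, `cIdx_torIdx`, `hasMaj_twoGridDefect_of_factorRates`), b05's Gram factorisation `B5QGGQ145Factor` (`QGRe = η^{d+1}KReᵀ`,
`QGRe_mul_KRe : Q′G′·G′Q′* = Q′G′²Q′*`, `KRe_decay`), `B5QGGQ145Bounds` (`kerRe_mul_qggqRe`, `qggqRe_mul_kerRe`: `kerRe = (Q′G′²Q′*)⁻¹`), `B5DPD126Uniform` (`conv_decay`,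
`kerRe_decay`), n15-c's `B6UnitTorusCarrier.card_fibre_blockOf`, n15-a part 4's `DefectKernel.card_fibre_kingProj`, King's `MinimizerBlockDecay.blockOf_over`.
WHAT.  (§48) `kerRe′ − kerRe = kerRe′·(N − N′)·kerRe` with `N = Q′G′²Q′* = qggqRe` (`kerRe_sub_eq`); the Gram entry `N(k,k′) = η^{d+1}Σ_z K_T(z,k)K_T(z,k′)` regrouped by unit blocks and,
on the fine grid, by King's cells (`gram_entry_eq_blocks`, `gram_entry_fine_eq_cells`); hence (§49) ★ `abs_gram_sub_le`: the PAIRED RATE `ρ₀` of `K_T` (`|K′_T(torIdx w′, k) − K_T(torIdx (pr w′), k)|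
≤ ρ₀·e^{−δ t(B(pr w′), k)}`) and the decay `C_K` of `K_T` give `|N′ − N|(k,k′) ≤ 2ρ₀C_K·K(δ∕2)·e^{−(δ∕2)t(k,k′)}`, and ★★ `abs_kerRe_sub_le`: with the decay `C_I` of `kerRe` on both grids,
`|kerRe′ − kerRe|(k,k′) ≤ C_I²·2ρ₀C_K·K(δ∕2)K(δ∕4)K(δ∕8)·e^{−(δ∕8)t(k,k′)}` — part 48's hypothesis `ρ₃`.  (§50) ★★ **`hasMaj_twoGridDefect_of_kernelPairRates`**: on the torus family of
record, the paired two-grid rates of `K_T` (`ρ₀`) and of `∂K_T` (`ρ₁`, part 48) for SOME couplings `a, a′ ∈ [a₋, a₊]` per member ⇒ ENTRY 0 of `𝔇(G′, G)` for Bałaban's full `G = Δ_{a₀}⁻¹`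
(all other inputs are the tree's: (1.110), (1.126) engine decays, parts 43–48).  So the located hard core of door (iv) entry 0 is now EXACTLY King's Prop. 3.8 (3.71) lines 1–2 READ FOR
b04's kernel `K_T = (Δ + aQ′*Q′)⁻¹Q′*` at `m² = 0` (tree: `King1986.MinimizerTwoSpacing.king_prop38_torus`, `…Deriv.king_prop38_deriv_torus`, mass-uniform twins — for King's
`minimiser` with `m² > 0`; dictionary `KT ↔ minimiser` + `m² → 0⁺` = the next files).
HONEST FRAMING ∕ LIMITS.  `ρ₀`, `ρ₁` are HYPOTHESES; nothing of [B5] asserted beyond the tree's theorems; constants crude and ours; tori of record; `U ≡ 1`; count-neutral (typed 28∕28 ·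
discharged 5∕28 unchanged); NOT a discharge of N15 (object-bound; NE2⁺ NOT PRINTED); one finite T⁴ at fixed ε — NOT infinite volume, NOT OS on ℝ⁴, NOT a mass gap, NOT Clay.
-/

noncomputable section

open scoped BigOperators Matrix
open Finset

namespace Summit.QuantumFields.YangMills.BalabanUVNodes.N15.TwoGrid

open Literature.MathematicalPhysics.QuantumFieldTheory.Balaban1983to89
open Literature.MathematicalPhysics.QuantumFieldTheory.Balaban1983to89.B11SectG (BlockNorm HasMaj)
open Literature.MathematicalPhysics.QuantumFieldTheory.Balaban1983to89.T4EtaRateCoeffDefect (pull fibre mem_fibre)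
open Literature.MathematicalPhysics.QuantumFieldTheory.Balaban1983to89.T4EtaRateDefect (idef)
open Literature.MathematicalPhysics.QuantumFieldTheory.Balaban1983to89.B5Prop11Plancherel (Tor fine unitVec)
open Literature.MathematicalPhysics.QuantumFieldTheory.Balaban1983to89.B5SiteBridgeP12 (MP)
open Literature.MathematicalPhysics.QuantumFieldTheory.Balaban1983to89.B4Sect5Torus (TSite tdist tdist_triangle tdist_symm tdist_nonneg tdist_self)
open Literature.MathematicalPhysics.QuantumFieldTheory.Balaban1983to89.B4Green244 (coarse)
open Literature.MathematicalPhysics.QuantumFieldTheory.Balaban1983to89.B4TorusKernel (periodConst)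
open Literature.MathematicalPhysics.QuantumFieldTheory.Balaban1983to89.B4TorusKernel.MultiPeriod (torusSupNorm)
open Literature.MathematicalPhysics.QuantumFieldTheory.Balaban1983to89.B5QGGQ145Bounds (Idx toZ kerRe qggqRe kerRe_mul_qggqRe qggqRe_mul_kerRe)
open Literature.MathematicalPhysics.QuantumFieldTheory.Balaban1983to89.B5QGGQ145Factor (KRe QGRe QGRe_apply QGRe_mul_KRe KRe_decay)
open Literature.MathematicalPhysics.QuantumFieldTheory.Balaban1983to89.B5DPD126Uniform (DKRe dpd cIdx toZ_cIdx conv_decay tdist_eq_torusSupNorm DKRe_decay kerRe_decay)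
open Literature.MathematicalPhysics.QuantumFieldTheory.Balaban1983to89.B5PBridgeProjection (torIdx torIdx_apply)
open Literature.MathematicalPhysics.QuantumFieldTheory.King1986.Torus (blockOf val_blockOf tdistT tdistT_nonneg blockOf_over)
open Literature.MathematicalPhysics.QuantumFieldTheory.Balaban1983to89.B6UnitTorusCarrier (unitTorusGeo card_fibre_blockOf)
open Summit.QuantumFields.YangMills.BalabanUVNodes.N15.DefectKernel (card_fibre_kingProj)
open Summit.QuantumFields.YangMills.BalabanUVNodes.N15.VectorPiece (blkFine kingPr kingPrV kingPr_val)

variable {d : ℕ}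

/-! ## §48 The resolvent identity on the unit torus and the Gram entries regrouped by blocks ∕ cells -/

section Gram

variable {L : ℕ} [NeZero L] (M : Fin (d + 1) → ℕ) [∀ μ, NeZero (M μ)] (k m : ℕ)

/-- **THE RESOLVENT IDENTITY ON THE UNIT TORUS**: `(Q′G′²Q′*)⁻¹′ − (Q′G′²Q′*)⁻¹ = (Q′G′²Q′*)⁻¹′·(N − N′)·(Q′G′²Q′*)⁻¹` (`kerRe·qggqRe = 1 = qggqRe·kerRe` on each grid; the unit torus is
common to both grids). [cite: Balaban1984PropagatorsI, (1.45) p.26, p.25 (Q′G′²Q′* invertible)] -/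
theorem kerRe_sub_eq {n n' : ℕ} [NeZero n] [NeZero n'] {a a' : ℝ} (ha : 0 < a) (ha' : 0 < a') :
    kerRe n' a' M - kerRe n a M = kerRe n' a' M * (qggqRe n a M - qggqRe n' a' M) * kerRe n a M := by
  have hM1 : ∀ i, 1 ≤ M i := fun i => Nat.one_le_iff_ne_zero.mpr (NeZero.ne (M i))
  have hn : 1 ≤ n := Nat.one_le_iff_ne_zero.mpr (NeZero.ne n)
  have hn' : 1 ≤ n' := Nat.one_le_iff_ne_zero.mpr (NeZero.ne n')
  rw [Matrix.mul_sub, Matrix.sub_mul, Matrix.mul_assoc, qggqRe_mul_kerRe n hn a ha hM1, Matrix.mul_one, kerRe_mul_qggqRe n' hn' a' ha' hM1, Matrix.one_mul]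

/-- the Gram entry `N(k,k′) = (Q′G′·G′Q′*)(k,k′) = η^{d+1}·Σ_{x ∈ T_η} K_T(x,k)K_T(x,k′)`, the fine sum read on King's torus type. [cite: Balaban1984PropagatorsI, p.25 («⟨ω, Q′G′²Q′*ω⟩ = ‖G′Q′*ω‖²»)] -/
theorem gram_entry_eq (n : ℕ) [NeZero n] {a : ℝ} (ha : 0 < a) (k₁ k₂ : Idx M) :
    qggqRe n a M k₁ k₂ = ((n : ℝ) ^ (d + 1))⁻¹ * ∑ x : Tor (fine n M), KRe n a M (torIdx (fine n M) x) k₁ * KRe n a M (torIdx (fine n M) x) k₂ := by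
  have hM1 : ∀ i, 1 ≤ M i := fun i => Nat.one_le_iff_ne_zero.mpr (NeZero.ne (M i))
  have hn : 1 ≤ n := Nat.one_le_iff_ne_zero.mpr (NeZero.ne n)
  rw [← QGRe_mul_KRe n hn a ha hM1, Matrix.mul_apply, mul_sum, ← (torIdx (fine n M)).sum_comp]
  refine sum_congr rfl fun x _ => ?_
  rw [QGRe_apply, mul_assoc]

/-- the coarse Gram entry regrouped by King's unit blocks: `N(k,k′) = Σ_b η^{d+1}Σ_{x ∈ B(b)} K(x,k)K(x,k′)`. [folklore] -/
theorem gram_entry_eq_blocks (n : ℕ) [NeZero n] {a : ℝ} (ha : 0 < a) (k₁ k₂ : Idx M) :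
    qggqRe n a M k₁ k₂ = ∑ b : Tor M, ((n : ℝ) ^ (d + 1))⁻¹ * ∑ x ∈ fibre (blockOf n M) b, KRe n a M (torIdx (fine n M) x) k₁ * KRe n a M (torIdx (fine n M) x) k₂ := by
  classical
  rw [gram_entry_eq M n ha, ← sum_fiberwise_of_maps_to (s := (univ : Finset (Tor (fine n M)))) (t := (univ : Finset (Tor M))) (g := blockOf n M)
    (fun x _ => mem_univ _), mul_sum]
  rfl

/-- the FINE Gram entry regrouped by King's cells over the coarse torus and then by unit blocks:
`N′(k,k′) = Σ_b η^{d+1}Σ_{x ∈ B(b)} L^{−m(d+1)}Σ_{w′: pr w′ = x} K′(w′,k)K′(w′,k′)`. [cite: King1986, p.664 (the pairing); Balaban1984PropagatorsI, p.25] -/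
theorem gram_entry_fine_eq_cells {a' : ℝ} (ha' : 0 < a') (k₁ k₂ : Idx M) :
    qggqRe (L ^ m * L ^ k) a' M k₁ k₂ = ∑ b : Tor M, (((L ^ k : ℕ) : ℝ) ^ (d + 1))⁻¹ * ∑ x ∈ fibre (blockOf (L ^ k) M) b,
      (((L ^ m : ℕ) : ℝ) ^ (d + 1))⁻¹ * ∑ w' ∈ fibre (kingPr L k m M) x,
        KRe (L ^ m * L ^ k) a' M (torIdx (fine (L ^ m * L ^ k) M) w') k₁ * KRe (L ^ m * L ^ k) a' M (torIdx (fine (L ^ m * L ^ k) M) w') k₂ := by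
  classical
  haveI : NeZero (L ^ m * L ^ k) := ⟨Nat.mul_ne_zero (pow_ne_zero _ (NeZero.ne L)) (pow_ne_zero _ (NeZero.ne L))⟩
  have hsplit : ((((L ^ m * L ^ k : ℕ) : ℝ)) ^ (d + 1))⁻¹ = (((L ^ k : ℕ) : ℝ) ^ (d + 1))⁻¹ * (((L ^ m : ℕ) : ℝ) ^ (d + 1))⁻¹ := by
    rw [← mul_inv]; push_cast; ring
  rw [gram_entry_eq M (L ^ m * L ^ k) ha', hsplit,
    ← sum_fiberwise_of_maps_to (s := (univ : Finset (Tor (fine (L ^ m * L ^ k) M)))) (t := (univ : Finset (Tor (fine (L ^ k) M)))) (g := kingPr L k m M)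
      (fun x _ => mem_univ _),
    ← sum_fiberwise_of_maps_to (s := (univ : Finset (Tor (fine (L ^ k) M)))) (t := (univ : Finset (Tor M))) (g := blockOf (L ^ k) M) (fun x _ => mem_univ _)]
  simp only [mul_sum]
  exact sum_congr rfl fun b _ => sum_congr rfl fun x _ => sum_congr rfl fun w' _ => by ring

end Gram

/-! ## §49 ★ The rate of the Gram matrix and ★★ of its inverse from the paired rate of `K_T` -/

section GramRate

variable {L : ℕ} [NeZero L] (M : Fin (d + 1) → ℕ) [∀ μ, NeZero (M μ)] (k m : ℕ)

/-- ★ **THE TWO-GRID RATE OF THE GRAM MATRIX `N = Q′G′²Q′*`**: the decay `C_K` of `K_T` on both grids and the PAIRED RATE `ρ₀` (`|K′_T(torIdx w′, k) − K_T(torIdx (pr w′), k)| ≤ ρ₀·e^{−δ t(B(pr w′),k)}`)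
give `|N′ − N|(k,k′) ≤ 2ρ₀C_K·K(δ∕2)·e^{−(δ∕2)t(k,k′)}` (Riemann weight `η^{d+1}` × `n^{d+1}` points per unit block = 1; the fine cell average is an average of paired differences).
[cite: Balaban1984PropagatorsI, p.25; King1986, Prop. 3.8 (3.71) p.664 (rate shape)] -/
theorem abs_gram_sub_le {a a' CK δ ρ₀ : ℝ} (ha : 0 < a) (ha' : 0 < a') (hCK : 0 ≤ CK) (hδ : 0 < δ) (hρ₀ : 0 ≤ ρ₀)
    (hK : ∀ (X : Idx (fun i => L ^ k * M i)) (k' : Idx M), |KRe (L ^ k) a M X k'| ≤ CK * Real.exp (-(δ * tdist M (cIdx (L ^ k) M X) k')))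
    (hK' : ∀ (X : Idx (fun i => (L ^ m * L ^ k) * M i)) (k' : Idx M), |KRe (L ^ m * L ^ k) a' M X k'| ≤ CK * Real.exp (-(δ * tdist M (cIdx (L ^ m * L ^ k) M X) k')))
    (hR0 : ∀ (w' : Tor (fine (L ^ m * L ^ k) M)) (k' : Idx M),
      |KRe (L ^ m * L ^ k) a' M (torIdx (fine (L ^ m * L ^ k) M) w') k' - KRe (L ^ k) a M (torIdx (fine (L ^ k) M) (kingPr L k m M w')) k'|
        ≤ ρ₀ * Real.exp (-(δ * tdist M (cIdx (L ^ k) M (torIdx (fine (L ^ k) M) (kingPr L k m M w'))) k')))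
    (k₁ k₂ : Idx M) :
    |qggqRe (L ^ m * L ^ k) a' M k₁ k₂ - qggqRe (L ^ k) a M k₁ k₂| ≤ 2 * ρ₀ * CK * B4Sect5Proof.latticeConst (d + 1) (δ / 2) * Real.exp (-(δ / 2 * tdist M k₁ k₂)) := by
  classical
  have hM1 : ∀ i, 1 ≤ M i := fun i => Nat.one_le_iff_ne_zero.mpr (NeZero.ne (M i))
  have hL0 : 0 < L := Nat.pos_of_ne_zero (NeZero.ne L)
  have hn0 : (0 : ℝ) < (((L ^ k : ℕ) : ℝ)) ^ (d + 1) := pow_pos (by exact_mod_cast Nat.one_le_pow _ _ hL0) _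
  have hRm0 : (0 : ℝ) < (((L ^ m : ℕ) : ℝ)) ^ (d + 1) := pow_pos (by exact_mod_cast Nat.one_le_pow _ _ hL0) _
  rw [gram_entry_fine_eq_cells M k m ha', gram_entry_eq_blocks M (L ^ k) ha, ← sum_sub_distrib]
  -- per unit block `b`: the cell-averaged fine products minus the coarse products
  have hblock : ∀ b : Tor M,
      |(((L ^ k : ℕ) : ℝ) ^ (d + 1))⁻¹ * ∑ x ∈ fibre (blockOf (L ^ k) M) b, (((L ^ m : ℕ) : ℝ) ^ (d + 1))⁻¹ * ∑ w' ∈ fibre (kingPr L k m M) x,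
            KRe (L ^ m * L ^ k) a' M (torIdx (fine (L ^ m * L ^ k) M) w') k₁ * KRe (L ^ m * L ^ k) a' M (torIdx (fine (L ^ m * L ^ k) M) w') k₂
        - (((L ^ k : ℕ) : ℝ) ^ (d + 1))⁻¹ * ∑ x ∈ fibre (blockOf (L ^ k) M) b,
            KRe (L ^ k) a M (torIdx (fine (L ^ k) M) x) k₁ * KRe (L ^ k) a M (torIdx (fine (L ^ k) M) x) k₂|
      ≤ 2 * ρ₀ * CK * (Real.exp (-(δ * tdist M (torIdx M b) k₁)) * Real.exp (-(δ * tdist M (torIdx M b) k₂))) := by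
    intro b
    rw [← mul_sub, ← sum_sub_distrib, abs_mul, abs_of_pos (inv_pos.mpr hn0)]
    -- per coarse site `x ∈ B(b)`
    have hx : ∀ x ∈ fibre (blockOf (L ^ k) M) b,
        |(((L ^ m : ℕ) : ℝ) ^ (d + 1))⁻¹ * ∑ w' ∈ fibre (kingPr L k m M) x,
              KRe (L ^ m * L ^ k) a' M (torIdx (fine (L ^ m * L ^ k) M) w') k₁ * KRe (L ^ m * L ^ k) a' M (torIdx (fine (L ^ m * L ^ k) M) w') k₂
          - KRe (L ^ k) a M (torIdx (fine (L ^ k) M) x) k₁ * KRe (L ^ k) a M (torIdx (fine (L ^ k) M) x) k₂|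
        ≤ 2 * ρ₀ * CK * (Real.exp (-(δ * tdist M (torIdx M b) k₁)) * Real.exp (-(δ * tdist M (torIdx M b) k₂))) := by
      intro x hxb
      have hxb' : blockOf (L ^ k) M x = b := (mem_fibre _ _ _).mp hxb
      have hbx : cIdx (L ^ k) M (torIdx (fine (L ^ k) M) x) = torIdx M b := by rw [cIdx_torIdx, hxb']
      have hcard : ((fibre (kingPr L k m M) x).card : ℝ) = ((L ^ m : ℕ) : ℝ) ^ (d + 1) := by
        rw [card_fibre_kingProj L k m M (kingPr L k m M) (kingPr_val L k m M) x]; push_cast; ring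
      -- the coarse product as the average of itself over the cell
      have havg : KRe (L ^ k) a M (torIdx (fine (L ^ k) M) x) k₁ * KRe (L ^ k) a M (torIdx (fine (L ^ k) M) x) k₂
          = (((L ^ m : ℕ) : ℝ) ^ (d + 1))⁻¹ * ∑ w' ∈ fibre (kingPr L k m M) x, KRe (L ^ k) a M (torIdx (fine (L ^ k) M) x) k₁ * KRe (L ^ k) a M (torIdx (fine (L ^ k) M) x) k₂ := by
        rw [sum_const, nsmul_eq_mul, hcard, ← mul_assoc, inv_mul_cancel₀ hRm0.ne', one_mul]
      rw [havg, ← mul_sub, ← sum_sub_distrib, abs_mul, abs_of_pos (inv_pos.mpr hRm0)]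
      have hw : ∀ w' ∈ fibre (kingPr L k m M) x,
          |KRe (L ^ m * L ^ k) a' M (torIdx (fine (L ^ m * L ^ k) M) w') k₁ * KRe (L ^ m * L ^ k) a' M (torIdx (fine (L ^ m * L ^ k) M) w') k₂
            - KRe (L ^ k) a M (torIdx (fine (L ^ k) M) x) k₁ * KRe (L ^ k) a M (torIdx (fine (L ^ k) M) x) k₂|
          ≤ 2 * ρ₀ * CK * (Real.exp (-(δ * tdist M (torIdx M b) k₁)) * Real.exp (-(δ * tdist M (torIdx M b) k₂))) := by
        intro w' hw'
        have hpr : kingPr L k m M w' = x := (mem_fibre _ _ _).mp hw'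
        have hbw : cIdx (L ^ m * L ^ k) M (torIdx (fine (L ^ m * L ^ k) M) w') = torIdx M b := by
          rw [cIdx_torIdx, blockOf_over M (kingPr L k m M w') w' (kingPr_val L k m M w'), hpr, hxb']
        set A' := KRe (L ^ m * L ^ k) a' M (torIdx (fine (L ^ m * L ^ k) M) w') k₁
        set B' := KRe (L ^ m * L ^ k) a' M (torIdx (fine (L ^ m * L ^ k) M) w') k₂
        set A := KRe (L ^ k) a M (torIdx (fine (L ^ k) M) x) k₁
        set B := KRe (L ^ k) a M (torIdx (fine (L ^ k) M) x) k₂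
        have e1 := Real.exp_nonneg (-(δ * tdist M (torIdx M b) k₁))
        have e2 := Real.exp_nonneg (-(δ * tdist M (torIdx M b) k₂))
        have hA'1 : |A' - A| ≤ ρ₀ * Real.exp (-(δ * tdist M (torIdx M b) k₁)) := by
          have h := hR0 w' k₁; rw [hpr, hbx] at h; exact h
        have hB'2 : |B' - B| ≤ ρ₀ * Real.exp (-(δ * tdist M (torIdx M b) k₂)) := by
          have h := hR0 w' k₂; rw [hpr, hbx] at h; exact h
        have hB' : |B'| ≤ CK * Real.exp (-(δ * tdist M (torIdx M b) k₂)) := by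
          have h := hK' (torIdx (fine (L ^ m * L ^ k) M) w') k₂; rw [hbw] at h; exact h
        have hA : |A| ≤ CK * Real.exp (-(δ * tdist M (torIdx M b) k₁)) := by
          have h := hK (torIdx (fine (L ^ k) M) x) k₁; rw [hbx] at h; exact h
        have hid : A' * B' - A * B = (A' - A) * B' + A * (B' - B) := by ring
        rw [hid]
        calc |(A' - A) * B' + A * (B' - B)| ≤ |A' - A| * |B'| + |A| * |B' - B| := by
              refine (abs_add_le _ _).trans ?_; rw [abs_mul, abs_mul]
          _ ≤ ρ₀ * Real.exp (-(δ * tdist M (torIdx M b) k₁)) * (CK * Real.exp (-(δ * tdist M (torIdx M b) k₂)))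
              + CK * Real.exp (-(δ * tdist M (torIdx M b) k₁)) * (ρ₀ * Real.exp (-(δ * tdist M (torIdx M b) k₂))) :=
            add_le_add (mul_le_mul hA'1 hB' (abs_nonneg _) (mul_nonneg hρ₀ e1)) (mul_le_mul hA hB'2 (abs_nonneg _) (mul_nonneg hCK e1))
          _ = 2 * ρ₀ * CK * (Real.exp (-(δ * tdist M (torIdx M b) k₁)) * Real.exp (-(δ * tdist M (torIdx M b) k₂))) := by ring
      calc (((L ^ m : ℕ) : ℝ) ^ (d + 1))⁻¹ * |∑ w' ∈ fibre (kingPr L k m M) x,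
              (KRe (L ^ m * L ^ k) a' M (torIdx (fine (L ^ m * L ^ k) M) w') k₁ * KRe (L ^ m * L ^ k) a' M (torIdx (fine (L ^ m * L ^ k) M) w') k₂
                - KRe (L ^ k) a M (torIdx (fine (L ^ k) M) x) k₁ * KRe (L ^ k) a M (torIdx (fine (L ^ k) M) x) k₂)|
          ≤ (((L ^ m : ℕ) : ℝ) ^ (d + 1))⁻¹ * ∑ w' ∈ fibre (kingPr L k m M) x, 2 * ρ₀ * CK * (Real.exp (-(δ * tdist M (torIdx M b) k₁)) * Real.exp (-(δ * tdist M (torIdx M b) k₂))) := by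
            gcongr; exact (abs_sum_le_sum_abs _ _).trans (sum_le_sum hw)
        _ = _ := by rw [sum_const, nsmul_eq_mul, hcard, ← mul_assoc, inv_mul_cancel₀ hRm0.ne', one_mul]
    have hcardB : ((fibre (blockOf (L ^ k) M) b).card : ℝ) = ((L ^ k : ℕ) : ℝ) ^ (d + 1) := by rw [card_fibre_blockOf]; push_cast; ring
    calc (((L ^ k : ℕ) : ℝ) ^ (d + 1))⁻¹ * |∑ x ∈ fibre (blockOf (L ^ k) M) b,
            ((((L ^ m : ℕ) : ℝ) ^ (d + 1))⁻¹ * ∑ w' ∈ fibre (kingPr L k m M) x,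
                KRe (L ^ m * L ^ k) a' M (torIdx (fine (L ^ m * L ^ k) M) w') k₁ * KRe (L ^ m * L ^ k) a' M (torIdx (fine (L ^ m * L ^ k) M) w') k₂
              - KRe (L ^ k) a M (torIdx (fine (L ^ k) M) x) k₁ * KRe (L ^ k) a M (torIdx (fine (L ^ k) M) x) k₂)|
        ≤ (((L ^ k : ℕ) : ℝ) ^ (d + 1))⁻¹ * ∑ x ∈ fibre (blockOf (L ^ k) M) b, 2 * ρ₀ * CK * (Real.exp (-(δ * tdist M (torIdx M b) k₁)) * Real.exp (-(δ * tdist M (torIdx M b) k₂))) := by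
          gcongr; exact (abs_sum_le_sum_abs _ _).trans (sum_le_sum hx)
      _ = _ := by rw [sum_const, nsmul_eq_mul, hcardB, ← mul_assoc, inv_mul_cancel₀ hn0.ne', one_mul]
  -- sum over the unit blocks: one convolution
  calc |∑ b : Tor M, ((((L ^ k : ℕ) : ℝ) ^ (d + 1))⁻¹ * ∑ x ∈ fibre (blockOf (L ^ k) M) b, (((L ^ m : ℕ) : ℝ) ^ (d + 1))⁻¹ * ∑ w' ∈ fibre (kingPr L k m M) x,
            KRe (L ^ m * L ^ k) a' M (torIdx (fine (L ^ m * L ^ k) M) w') k₁ * KRe (L ^ m * L ^ k) a' M (torIdx (fine (L ^ m * L ^ k) M) w') k₂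
          - (((L ^ k : ℕ) : ℝ) ^ (d + 1))⁻¹ * ∑ x ∈ fibre (blockOf (L ^ k) M) b, KRe (L ^ k) a M (torIdx (fine (L ^ k) M) x) k₁ * KRe (L ^ k) a M (torIdx (fine (L ^ k) M) x) k₂)|
      ≤ ∑ b : Tor M, 2 * ρ₀ * CK * (Real.exp (-(δ * tdist M (torIdx M b) k₁)) * Real.exp (-(δ * tdist M (torIdx M b) k₂))) :=
        (abs_sum_le_sum_abs _ _).trans (sum_le_sum fun b _ => hblock b)
    _ = 2 * ρ₀ * CK * ∑ c : Idx M, Real.exp (-(δ * tdist M k₁ c)) * Real.exp (-(δ * tdist M c k₂)) := by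
        rw [← mul_sum, ← (torIdx M).sum_comp fun c => Real.exp (-(δ * tdist M k₁ c)) * Real.exp (-(δ * tdist M c k₂))]
        refine congrArg _ (sum_congr rfl fun b _ => ?_)
        rw [tdist_symm hM1 k₁]
    _ ≤ 2 * ρ₀ * CK * (1 * 1 * B4Sect5Proof.latticeConst (d + 1) (δ / 2) * Real.exp (-(δ / 2 * tdist M k₁ k₂))) := by
        refine mul_le_mul_of_nonneg_left ?_ (by positivity)
        have h := conv_decay hM1 hδ (fun c => Real.exp (-(δ * tdist M k₁ c))) (fun c => Real.exp (-(δ * tdist M c k₂))) k₁ k₂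
          (fun c => by rw [abs_of_nonneg (Real.exp_nonneg _), one_mul]) (fun c => by rw [abs_of_nonneg (Real.exp_nonneg _), one_mul])
        exact (le_abs_self _).trans h
    _ = 2 * ρ₀ * CK * B4Sect5Proof.latticeConst (d + 1) (δ / 2) * Real.exp (-(δ / 2 * tdist M k₁ k₂)) := by ring

/-- ★★ **THE TWO-GRID RATE OF `(Q′G′²Q′*)⁻¹`** (part 48's hypothesis `ρ₃`): the decays `C_K` of `K_T` and `C_I` of `(Q′G′²Q′*)⁻¹` on both grids and the paired rate `ρ₀` of `K_T` give
`|kerRe′ − kerRe|(k,k′) ≤ C_I²·(2ρ₀C_K·K(δ∕2))·K(δ∕4)·K(δ∕8)·e^{−(δ∕8)t(k,k′)}` (resolvent identity + triple convolution at rate `δ∕2`). [cite: Balaban1984PropagatorsI, (1.45) p.26; King1986, Prop. 3.8 (3.71) p.664 (rate shape)] -/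
theorem abs_kerRe_sub_le {a a' CK CI δ ρ₀ : ℝ} (ha : 0 < a) (ha' : 0 < a') (hCK : 0 ≤ CK) (hCI : 0 ≤ CI) (hδ : 0 < δ) (hρ₀ : 0 ≤ ρ₀)
    (hK : ∀ (X : Idx (fun i => L ^ k * M i)) (k' : Idx M), |KRe (L ^ k) a M X k'| ≤ CK * Real.exp (-(δ * tdist M (cIdx (L ^ k) M X) k')))
    (hK' : ∀ (X : Idx (fun i => (L ^ m * L ^ k) * M i)) (k' : Idx M), |KRe (L ^ m * L ^ k) a' M X k'| ≤ CK * Real.exp (-(δ * tdist M (cIdx (L ^ m * L ^ k) M X) k')))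
    (hI : ∀ k₁ k₂ : Idx M, |kerRe (L ^ k) a M k₁ k₂| ≤ CI * Real.exp (-(δ * tdist M k₁ k₂)))
    (hI' : ∀ k₁ k₂ : Idx M, |kerRe (L ^ m * L ^ k) a' M k₁ k₂| ≤ CI * Real.exp (-(δ * tdist M k₁ k₂)))
    (hR0 : ∀ (w' : Tor (fine (L ^ m * L ^ k) M)) (k' : Idx M),
      |KRe (L ^ m * L ^ k) a' M (torIdx (fine (L ^ m * L ^ k) M) w') k' - KRe (L ^ k) a M (torIdx (fine (L ^ k) M) (kingPr L k m M w')) k'|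
        ≤ ρ₀ * Real.exp (-(δ * tdist M (cIdx (L ^ k) M (torIdx (fine (L ^ k) M) (kingPr L k m M w'))) k')))
    (k₁ k₂ : Idx M) :
    |kerRe (L ^ m * L ^ k) a' M k₁ k₂ - kerRe (L ^ k) a M k₁ k₂|
      ≤ CI * (2 * ρ₀ * CK * B4Sect5Proof.latticeConst (d + 1) (δ / 2)) * CI * B4Sect5Proof.latticeConst (d + 1) (δ / 2 / 2) * B4Sect5Proof.latticeConst (d + 1) (δ / 2 / 4)
        * Real.exp (-(δ / 2 / 4 * tdist M k₁ k₂)) := by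
  classical
  have hM1 : ∀ i, 1 ≤ M i := fun i => Nat.one_le_iff_ne_zero.mpr (NeZero.ne (M i))
  haveI : NeZero (L ^ m * L ^ k) := ⟨Nat.mul_ne_zero (pow_ne_zero _ (NeZero.ne L)) (pow_ne_zero _ (NeZero.ne L))⟩
  have hres := kerRe_sub_eq M (n := L ^ k) (n' := L ^ m * L ^ k) ha ha'
  have hentry : (kerRe (L ^ m * L ^ k) a' M - kerRe (L ^ k) a M) k₁ k₂ = kerRe (L ^ m * L ^ k) a' M k₁ k₂ - kerRe (L ^ k) a M k₁ k₂ := rfl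
  rw [← hentry, hres, Matrix.mul_apply]
  simp only [Matrix.mul_apply, Matrix.sub_apply]
  rw [show (∑ j, (∑ i, kerRe (L ^ m * L ^ k) a' M k₁ i * (qggqRe (L ^ k) a M i j - qggqRe (L ^ m * L ^ k) a' M i j)) * kerRe (L ^ k) a M j k₂)
      = ∑ j, (∑ i, kerRe (L ^ m * L ^ k) a' M k₁ i * (qggqRe (L ^ k) a M i j - qggqRe (L ^ m * L ^ k) a' M i j)) * kerRe (L ^ k) a M j k₂ from rfl]
  have hδ2 : 0 < δ / 2 := half_pos hδ
  have hf : ∀ i, |kerRe (L ^ m * L ^ k) a' M k₁ i| ≤ CI * Real.exp (-(δ / 2 * tdist M k₁ i)) := fun i =>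
    (hI' k₁ i).trans (mul_le_mul_of_nonneg_left (Real.exp_le_exp.mpr (by nlinarith [tdist_nonneg M k₁ i])) hCI)
  have hg : ∀ i j, |qggqRe (L ^ k) a M i j - qggqRe (L ^ m * L ^ k) a' M i j| ≤ 2 * ρ₀ * CK * B4Sect5Proof.latticeConst (d + 1) (δ / 2) * Real.exp (-(δ / 2 * tdist M i j)) :=
    fun i j => by rw [abs_sub_comm]; exact abs_gram_sub_le M k m ha ha' hCK hδ hρ₀ hK hK' hR0 i j
  have hh : ∀ j, |kerRe (L ^ k) a M j k₂| ≤ CI * Real.exp (-(δ / 2 * tdist M j k₂)) := fun j =>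
    (hI j k₂).trans (mul_le_mul_of_nonneg_left (Real.exp_le_exp.mpr (by nlinarith [tdist_nonneg M j k₂])) hCI)
  exact abs_sum_mul_sum_mul_le hM1 hδ2 hCI (fun i => kerRe (L ^ m * L ^ k) a' M k₁ i) (fun i j => qggqRe (L ^ k) a M i j - qggqRe (L ^ m * L ^ k) a' M i j)
    (fun j => kerRe (L ^ k) a M j k₂) k₁ k₂ hf hg hh

end GramRate

/-! ## §50 ★★ Entry 0 of `𝔇(G′, G)` from the paired rates of `K_T` and `∂K_T` alone -/

section PairRates

variable {L : ℕ} [NeZero L]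

/-- ★★ **ENTRY 0 OF `𝔇(G′, G)` FOR BAŁABAN's FULL PROPAGATOR FROM THE TWO-GRID RATES OF ONE SCALAR KERNEL AND ITS GRADIENT.**  For odd `L > 1`, `a₀ > 0`, `0 < a₋ ≤ a₊`, `0 ≤ γ < 1`,
`δ_R, ρ > 0`: IF on every member of the torus family of record there are couplings `a, a′ ∈ [a₋, a₊]` such that b04's kernel `K_T = G′Q′*` (`KRe`) and its forward gradient (`DKRe`) have
the PAIRED two-grid rates `|K′(torIdx w′, k) − K(torIdx (pr w′), k)| ≤ ρ(L^k)^{−γ}e^{−δ_R t(B(pr w′),k)}` (King's Prop. 3.8 (3.71) lines 1–2 SHAPE), THEN `𝔇(G′, G) = idef P P G′ G` for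
`G = Δ_{a₀}⁻¹` has a block majorant `C·(L^k)^{−γ}·e^{−δ|y−y′|_T}`.  Everything else is the tree's: (1.110) both members, the (1.126) engine's decays (`KRe_decay`, `DKRe_decay`,
`kerRe_decay`, uniform on `[a₋,a₊]`), parts 43–49. [cite: Balaban1984PropagatorsI, Prop. 1.2 (1.110) p.35, (1.126) p.38, (1.45) p.26; King1986, Prop. 3.8 (3.71) p.664, Prop. 3.9 p.664] -/
theorem hasMaj_twoGridDefect_of_kernelPairRates (hL : Odd L ∧ 1 < L) {a₀ : ℝ} (ha₀ : 0 < a₀) {aminus aplus : ℝ} (hamin : 0 < aminus) {γ : ℝ} (hγ0 : 0 ≤ γ) (hγ1 : γ < 1)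
    {δR ρ : ℝ} (hδR : 0 < δR) (hρ : 0 < ρ)
    (hpair : ∀ (mT k m : ℕ) (hk : 1 ≤ k), ∃ a a' : ℝ, aminus ≤ a ∧ a ≤ aplus ∧ aminus ≤ a' ∧ a' ≤ aplus ∧
      (∀ (w' : Tor (fine (L ^ m * L ^ k) (MP (paramsOf d L mT k hL)))) (k' : Idx (MP (paramsOf d L mT k hL))),
        |KRe (L ^ m * L ^ k) a' (MP (paramsOf d L mT k hL)) (torIdx (fine (L ^ m * L ^ k) (MP (paramsOf d L mT k hL))) w') k'
            - KRe (L ^ k) a (MP (paramsOf d L mT k hL)) (torIdx (fine (L ^ k) (MP (paramsOf d L mT k hL))) (kingPr L k m (MP (paramsOf d L mT k hL)) w')) k'|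
          ≤ ρ * ((L ^ k : ℕ) : ℝ) ^ (-γ) *
            Real.exp (-(δR * tdist (MP (paramsOf d L mT k hL)) (cIdx (L ^ k) (MP (paramsOf d L mT k hL)) (torIdx (fine (L ^ k) (MP (paramsOf d L mT k hL))) (kingPr L k m (MP (paramsOf d L mT k hL)) w'))) k'))) ∧
      (∀ (s : Fin (d + 1)) (w' : Tor (fine (L ^ m * L ^ k) (MP (paramsOf d L mT k hL)))) (k' : Idx (MP (paramsOf d L mT k hL))),
        |DKRe (L ^ m * L ^ k) a' (MP (paramsOf d L mT k hL)) s (torIdx (fine (L ^ m * L ^ k) (MP (paramsOf d L mT k hL))) w') k'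
            - DKRe (L ^ k) a (MP (paramsOf d L mT k hL)) s (torIdx (fine (L ^ k) (MP (paramsOf d L mT k hL))) (kingPr L k m (MP (paramsOf d L mT k hL)) w')) k'|
          ≤ ρ * ((L ^ k : ℕ) : ℝ) ^ (-γ) *
            Real.exp (-(δR * tdist (MP (paramsOf d L mT k hL)) (cIdx (L ^ k) (MP (paramsOf d L mT k hL)) (torIdx (fine (L ^ k) (MP (paramsOf d L mT k hL))) (kingPr L k m (MP (paramsOf d L mT k hL)) w'))) k')))) :
    ∃ δ C : ℝ, 0 < δ ∧ 0 < C ∧ ∀ (mT k m : ℕ) (hk : 1 ≤ k),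
      HasMaj (BlockNorm.ofBlocks (unitTorusGeo L k (MP (paramsOf d L mT k hL))) (blkFine L k (MP (paramsOf d L mT k hL))))
        (BlockNorm.ofBlocks (unitTorusGeo L k (MP (paramsOf d L mT k hL)))
          (fun i : Tor (fine (L ^ m * L ^ k) (MP (paramsOf d L mT k hL))) × Fin (d + 1) => blockOf (L ^ m * L ^ k) (MP (paramsOf d L mT k hL)) i.1))
        (idef (pull (kingPrV L k m (MP (paramsOf d L mT k hL)))) (pull (kingPrV L k m (MP (paramsOf d L mT k hL))))
          (gOp (MP (paramsOf d L mT k hL)) (L ^ m * L ^ k) a₀) (gOp (MP (paramsOf d L mT k hL)) (L ^ k) a₀))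
        (fun y y' => C * ((L ^ k : ℕ) : ℝ) ^ (-γ) * Real.exp (-(δ * tdistT (MP (paramsOf d L mT k hL)) y y'))) := by
  -- the tree's uniform decays on `[a₋, a₊]`
  obtain ⟨κ₁, M₁, hκ₁, hM₁, HKd⟩ := KRe_decay d aminus aplus hamin
  obtain ⟨κ₂, M₂, hκ₂, hM₂, HId⟩ := kerRe_decay d aminus aplus hamin
  have hd1 : (0 : ℝ) < (d : ℝ) + 1 := by positivity
  obtain ⟨δ, hδ⟩ : ∃ δ : ℝ, δ = min (min (κ₁ / (d + 1)) (κ₂ / (d + 1))) δR := ⟨_, rfl⟩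
  have hδpos : 0 < δ := hδ ▸ lt_min (lt_min (div_pos hκ₁ hd1) (div_pos hκ₂ hd1)) hδR
  have hδ1 : δ ≤ κ₁ / (d + 1) := hδ ▸ (min_le_left _ _).trans (min_le_left _ _)
  have hδ2 : δ ≤ κ₂ / (d + 1) := hδ ▸ (min_le_left _ _).trans (min_le_right _ _)
  have hδ3 : δ ≤ δR := hδ ▸ min_le_right _ _
  have hpc1 : 0 ≤ periodConst κ₁ d := (B5Kernel166Decay.periodConst_pos hκ₁ d).le
  have hpc2 : 0 ≤ periodConst κ₂ d := (B5Kernel166Decay.periodConst_pos hκ₂ d).le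
  obtain ⟨CK, hCK⟩ : ∃ CK : ℝ, CK = M₁ * periodConst κ₁ d := ⟨_, rfl⟩
  obtain ⟨CI, hCI⟩ : ∃ CI : ℝ, CI = M₂ * periodConst κ₂ d := ⟨_, rfl⟩
  have hCK0 : 0 ≤ CK := hCK ▸ mul_nonneg hM₁ hpc1
  have hCI0 : 0 ≤ CI := hCI ▸ mul_nonneg hM₂ hpc2
  have hK2 : 0 ≤ B4Sect5Proof.latticeConst (d + 1) (δ / 2) := B4Sect5Proof.latticeConst_nonneg _ (by positivity)
  have hK4 : 0 ≤ B4Sect5Proof.latticeConst (d + 1) (δ / 2 / 2) := B4Sect5Proof.latticeConst_nonneg _ (by positivity)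
  have hK8 : 0 ≤ B4Sect5Proof.latticeConst (d + 1) (δ / 2 / 4) := B4Sect5Proof.latticeConst_nonneg _ (by positivity)
  -- the constant of `ρ₃` per unit of `ρ(L^k)^{−γ}`
  obtain ⟨C3, hC3⟩ : ∃ C3 : ℝ, C3 = CI * (2 * CK * B4Sect5Proof.latticeConst (d + 1) (δ / 2)) * CI * B4Sect5Proof.latticeConst (d + 1) (δ / 2 / 2) *
      B4Sect5Proof.latticeConst (d + 1) (δ / 2 / 4) := ⟨_, rfl⟩
  have hC30 : 0 ≤ C3 := hC3 ▸ mul_nonneg (mul_nonneg (mul_nonneg (mul_nonneg hCI0 (by positivity)) hCI0) hK4) hK8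
  refine hasMaj_twoGridDefect_of_factorRates (d := d) (aplus := aplus) hL ha₀ hamin hγ0 hγ1 (δR := δ / 2 / 4) (ρ := ρ * (C3 + 1)) (by positivity) (by positivity) fun mT k m hk => ?_
  obtain ⟨a, a', ha1, ha2, ha1', ha2', HR0, HR1⟩ := hpair mT k m hk
  have ha : 0 < a := hamin.trans_le ha1
  have ha' : 0 < a' := hamin.trans_le ha1'
  refine ⟨a, a', ha1, ha2, ha1', ha2', fun s w' k' => ?_, fun k₁ k₂ => ?_⟩
  · -- the gradient rate, with the weaker rate `δ/8` and the larger constant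
    have hL0 : 0 < L := Nat.pos_of_ne_zero (NeZero.ne L)
    have hn0 : (0 : ℝ) < ((L ^ k : ℕ) : ℝ) := by exact_mod_cast Nat.one_le_pow _ _ hL0
    have hrγ : 0 ≤ ((L ^ k : ℕ) : ℝ) ^ (-γ) := Real.rpow_nonneg hn0.le _
    refine (HR1 s w' k').trans ?_
    have ht := tdist_nonneg (MP (paramsOf d L mT k hL)) (cIdx (L ^ k) (MP (paramsOf d L mT k hL)) (torIdx (fine (L ^ k) (MP (paramsOf d L mT k hL))) (kingPr L k m (MP (paramsOf d L mT k hL)) w'))) k'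
    refine mul_le_mul (mul_le_mul_of_nonneg_right (le_mul_of_one_le_right hρ.le (by linarith)) hrγ) (Real.exp_le_exp.mpr (by nlinarith)) (Real.exp_nonneg _)
      (mul_nonneg (by positivity) hrγ)
  · -- the inverse's rate from `abs_kerRe_sub_le`
    have hM1 : ∀ i, 1 ≤ MP (paramsOf d L mT k hL) i := fun i => Nat.one_le_iff_ne_zero.mpr (NeZero.ne (MP (paramsOf d L mT k hL) i))
    have hL0 : 0 < L := Nat.pos_of_ne_zero (NeZero.ne L)
    haveI : NeZero (L ^ m * L ^ k) := ⟨Nat.mul_ne_zero (pow_ne_zero _ (NeZero.ne L)) (pow_ne_zero _ (NeZero.ne L))⟩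
    have hn0 : (0 : ℝ) < ((L ^ k : ℕ) : ℝ) := by exact_mod_cast Nat.one_le_pow _ _ hL0
    have hrγ : 0 ≤ ((L ^ k : ℕ) : ℝ) ^ (-γ) := Real.rpow_nonneg hn0.le _
    have hmono : ∀ {C pc κ' CC : ℝ} {N0 : Fin (d + 1) → ℕ} (_ : ∀ i, 1 ≤ N0 i) (X k' : Idx N0), 0 ≤ CC → C * pc ≤ CC → δ ≤ κ' →
        C * pc * Real.exp (-(κ' * torusSupNorm N0 (toZ X - toZ k'))) ≤ CC * Real.exp (-(δ * tdist N0 X k')) := by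
      intro C pc κ' CC N0 hN0 X k' hCC hC hκ
      rw [← tdist_eq_torusSupNorm hN0]
      have ht := tdist_nonneg N0 X k'
      by_cases hCp : 0 ≤ C * pc
      · have hexp : Real.exp (-(κ' * tdist N0 X k')) ≤ Real.exp (-(δ * tdist N0 X k')) :=
          Real.exp_le_exp.mpr (by nlinarith [mul_le_mul_of_nonneg_right hκ ht])
        exact mul_le_mul hC hexp (Real.exp_nonneg _) hCC
      · have h1 : C * pc * Real.exp (-(κ' * tdist N0 X k')) ≤ 0 :=
          mul_nonpos_of_nonpos_of_nonneg (le_of_lt (not_le.mp hCp)) (Real.exp_nonneg _)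
        exact h1.trans (mul_nonneg hCC (Real.exp_nonneg _))
    have hKn : ∀ (n : ℕ) [NeZero n] {b : ℝ}, aminus ≤ b → b ≤ aplus → ∀ (X : Idx (fun i => n * MP (paramsOf d L mT k hL) i)) (k' : Idx (MP (paramsOf d L mT k hL))),
        |KRe n b (MP (paramsOf d L mT k hL)) X k'| ≤ CK * Real.exp (-(δ * tdist (MP (paramsOf d L mT k hL)) (cIdx n (MP (paramsOf d L mT k hL)) X) k')) := by
      intro n _ b hb1 hb2 X k'
      have h := HKd n b hb1 hb2 (MP (paramsOf d L mT k hL)) hM1 X k'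
      rw [← toZ_cIdx] at h
      exact h.trans (hmono hM1 (cIdx n (MP (paramsOf d L mT k hL)) X) k' hCK0 (hCK ▸ le_rfl) hδ1)
    have hIn : ∀ (n : ℕ) [NeZero n] {b : ℝ}, aminus ≤ b → b ≤ aplus → ∀ k₁ k₂ : Idx (MP (paramsOf d L mT k hL)),
        |kerRe n b (MP (paramsOf d L mT k hL)) k₁ k₂| ≤ CI * Real.exp (-(δ * tdist (MP (paramsOf d L mT k hL)) k₁ k₂)) := by
      intro n _ b hb1 hb2 k₁ k₂
      exact (HId n b hb1 hb2 (MP (paramsOf d L mT k hL)) hM1 k₁ k₂).trans (hmono hM1 k₁ k₂ hCI0 (hCI ▸ le_rfl) hδ2)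
    have hR0' : ∀ (w' : Tor (fine (L ^ m * L ^ k) (MP (paramsOf d L mT k hL)))) (k' : Idx (MP (paramsOf d L mT k hL))),
        |KRe (L ^ m * L ^ k) a' (MP (paramsOf d L mT k hL)) (torIdx (fine (L ^ m * L ^ k) (MP (paramsOf d L mT k hL))) w') k'
            - KRe (L ^ k) a (MP (paramsOf d L mT k hL)) (torIdx (fine (L ^ k) (MP (paramsOf d L mT k hL))) (kingPr L k m (MP (paramsOf d L mT k hL)) w')) k'|
          ≤ ρ * ((L ^ k : ℕ) : ℝ) ^ (-γ) *
            Real.exp (-(δ * tdist (MP (paramsOf d L mT k hL)) (cIdx (L ^ k) (MP (paramsOf d L mT k hL)) (torIdx (fine (L ^ k) (MP (paramsOf d L mT k hL))) (kingPr L k m (MP (paramsOf d L mT k hL)) w'))) k')) :=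
      fun w' k' => (HR0 w' k').trans (mul_le_mul_of_nonneg_left (Real.exp_le_exp.mpr (by
        nlinarith [tdist_nonneg (MP (paramsOf d L mT k hL)) (cIdx (L ^ k) (MP (paramsOf d L mT k hL)) (torIdx (fine (L ^ k) (MP (paramsOf d L mT k hL))) (kingPr L k m (MP (paramsOf d L mT k hL)) w'))) k']))
        (mul_nonneg hρ.le hrγ))
    have h3 := abs_kerRe_sub_le (MP (paramsOf d L mT k hL)) k m ha ha' hCK0 hCI0 hδpos (mul_nonneg hρ.le hrγ)
      (hKn (L ^ k) ha1 ha2) (hKn (L ^ m * L ^ k) ha1' ha2') (hIn (L ^ k) ha1 ha2) (hIn (L ^ m * L ^ k) ha1' ha2') hR0' k₁ k₂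
    refine h3.trans ?_
    have hE := Real.exp_nonneg (-(δ / 2 / 4 * tdist (MP (paramsOf d L mT k hL)) k₁ k₂))
    have heq : CI * (2 * (ρ * ((L ^ k : ℕ) : ℝ) ^ (-γ)) * CK * B4Sect5Proof.latticeConst (d + 1) (δ / 2)) * CI * B4Sect5Proof.latticeConst (d + 1) (δ / 2 / 2) *
        B4Sect5Proof.latticeConst (d + 1) (δ / 2 / 4) = ρ * C3 * ((L ^ k : ℕ) : ℝ) ^ (-γ) := by rw [hC3]; ring
    rw [heq]
    refine mul_le_mul_of_nonneg_right ?_ hE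
    calc ρ * C3 * ((L ^ k : ℕ) : ℝ) ^ (-γ) ≤ ρ * (C3 + 1) * ((L ^ k : ℕ) : ℝ) ^ (-γ) :=
          mul_le_mul_of_nonneg_right (mul_le_mul_of_nonneg_left (by linarith) hρ.le) hrγ
      _ = _ := rfl

end PairRates

end Summit.QuantumFields.YangMills.BalabanUVNodes.N15.TwoGrid
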